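import Summits.BirchSwinnertonDyer.BirchSwinnertonDyer.Theorems.SignedLowerHalvesKobayashiLowerHalfSemistableSignDefect
import HarnessLib

/-!
# Crux `KobayashiLowerHalfSemistable` (route `SignedLowerHalves`, item 2 = stmt-BirchSwinnertonDyer-19000),
# line `birth_musplit`: the sign-defect identity READ ON CLASS X6 — the typed Eisenstein half is Kato's
# Eisenstein half seam by seam, and on a joint package the crux's `∃ ε` is `∀ ε`

HONEST FRAMING (cell `bsd-ssimc`, seat `bsd-line-slh-p2` gen 5): TOOL THEOREMS ONLY — no definition, no
named fact minted, no `sorry`, axioms standard; CONDITIONAL on the displayed published facts `h12`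
(Kobayashi Thm. 1.2), `h5`/`h3` (Greenberg–Vatsal Rem. 3.4 + Manin constant), `hPkg` (Kobayashi Thm.
6.2/6.3/7.3 i) + Kato Thm. 12.6, the tree's `thm62_63_73_signedColemanKato_zeta`) and, for the sign swap,
on a displayed JOINT-package hypothesis `hJ` (both signs on one zeta submodule `Z(T)` — in print
Kobayashi's three sequences in the proof of Thm. 7.4 start at the same `𝐇¹(T)^Δ/Z(T)^Δ`; the tree's
one-sign fact forgets it, exactly as `Sprung2012.thm714seq_sharpFlatColemanKato_zeta` vs `…_zetaJoint`;
no named fact is minted for it here). Nothing here is a theorem about a curve; the crux, line and route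
stay OPEN; BSD is not proved by any of this. `--supports stmt-BirchSwinnertonDyer-19000`.

WHAT (all on class X6 at an odd prime — `good`, `a_p = 0`, `ρ̄` irreducible automatic; Pollack's pair
exists unconditionally, `pollack_exists_plusMinusPAdicLFunction_holds`):
* §5 `X6.kobayashiLowerDivisibility_iff_katoEisenstein` — `KobayashiLowerDivisibility W p ε` ⟺ Kato's
  Eisenstein inclusion `char X₀ ⊆ char(𝐇¹/Z)` on every sign-`ε` package; `X6.kobayashiLowerDivisibility_of_jointZ`
  — on a joint package the Eisenstein half for one sign gives it for the other;
  `X6.exists_kobayashiLowerDivisibility_iff_forall_of_jointZ` — the crux's `∃ ε` is `∀ ε`.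
* §6 the registered stubs of line `birth_musplit` in Kato currency: the RATIONAL stub's clause (every
  sign) ⟺ `p^t · char X₀ ⊆ char(𝐇¹/Z)` on every package (`X6.forall_dvd_C_pow_mul_iff_kato`), and the
  `μ`-stub's clause for a sign ⟺ `μ(char 𝐇¹/Z) ≤ μ(char X₀)` on every package of that sign
  (`X6.forall_mu_le_iff_kato`); on a joint package both are sign-blind (`…_of_jointZ`), so the `∀ ε` of
  `stub_*_rational` and the `∃ ε` of `stub_*_mu` carry no content beyond one sign.

References: [Kobayashi2003] Thm. 1.2, §5 (p. 10), Thm. 7.4 and its proof (p. 13); [Kato2004Asterisque]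
Conj. 12.10 (p. 224); [Pollack2003] Thm. 5.6, Cor. 5.11, Conj. 6.3; [GreenbergVatsal2000] §3 Rem. 3.4.
-/

set_option autoImplicit false
-- single-problem summit (D-0017): the doubled namespace component is by design
set_option linter.dupNamespace false

noncomputable section

open scoped Classical MatrixGroups ModularForm

open CongruenceSubgroup Field WeierstrassCurve Literature.NumberTheory.EllipticCurves
  Literature.NumberTheory.EllipticCurves.ModularForms Literature.NumberTheory.GaloisRepresentations
  Literature.NumberTheory.EllipticCurves.Rank1Residual
  Literature.NumberTheory.EllipticCurves.Rank1Residual.Typed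
  Summit.BirchSwinnertonDyer.Rank1Residual.Supersingular
  Summit.BirchSwinnertonDyer.Rank1Residual.X1

namespace Summit.BirchSwinnertonDyer.BirchSwinnertonDyer.Theorems.SignDefect

/-! ## §5 On the crux's class X6 (odd `p`; `good`, `a_p = 0`, `ρ̄` irreducible automatic): the typed
Eisenstein half IS Kato's Eisenstein half, seam by seam; on a joint package the sign is idle -/

section X6

variable (W : WeierstrassCurve ℚ) [W.IsElliptic] [W.IsGloballyMinimal] (p : ℕ) [Fact p.Prime]
  [ContinuousSMul ℤ_[p] (W.tateModule p)] [Module.Free ℤ_[p] (W.tateModule p)]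
  [Module.Finite ℤ_[p] (W.tateModule p)]

/-- **`KobayashiLowerDivisibility W p ε` ⟺ Kato's Eisenstein inclusion on every sign-`ε` package** (class
X6, odd `p`), granted BY NAME Kobayashi Thm. 1.2 (`h12`, torsion of `X^ε`), the period comparisons
`h5`/`h3` (`ord_p ϖ = 0`) and the package construction fact `hPkg` (Kobayashi Thm. 6.2/6.3/7.3 i) + Kato
12.6); Pollack's pair exists unconditionally (`pollack_exists_plusMinusPAdicLFunction_holds`). RHS =
`∀` frames, `∀ I Y d`, `char X₀ ⊆ char(𝐇¹/Z)` — Kato's Conjecture 12.10, Eisenstein half, read on the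
`Δ`-trivial package. [cite: Kobayashi2003, Thm. 7.4 and its proof (p. 13)] [cite: Kato2004Asterisque, Conj. 12.10 (p. 224)] -/
theorem X6.kobayashiLowerDivisibility_iff_katoEisenstein
    (h12 : Kobayashi2003.thm12_signedSelmerDual_finite_torsion)
    (h5 : realPeriodRat_eq_unit_mul_plusPeriod) (h3 : realPeriodRat_eq_unit_mul_plusPeriod_three)
    (hPkg : Kobayashi2003.thm62_63_73_signedColemanKato_zeta)
    (hp : p ≠ 2) (hX : ClassX6 W p) (ε : ℤˣ) :
    KobayashiLowerDivisibility W p ε ↔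
    ∀ (κ : ZpExtension ℚ p) (γ : absoluteGaloisGroup ℚ),
      κ.IsCyclotomic → κ.IsTopGenerator γ → IsCyclotomicVariable p γ →
    ∀ [NeZero (W.conductorNorm ℤ)] (f : CuspForm (Gamma0 (W.conductorNorm ℤ)) 2),
      IsNewformOf W f → ∀ (ϖ : ℚ), (ϖ : ℝ) * W.realPeriodRat = plusPeriod f →
    ∀ (I : Kato2004.IwasawaH1Data W p κ γ) (Y : W.FineSelmerDualData κ γ)
      (d : Kobayashi2003.SignedColemanKatoData W p f ϖ κ γ ε I),
      Module.charIdeal (IwasawaAlgebra p) Y.X ≤ Module.charIdeal (IwasawaAlgebra p) (I.H ⧸ d.Z) := by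
  have hgood := hX.1.1
  have hap := ClassX6.frobeniusTrace_eq_zero W p hp hX
  have hirr := ClassX6.irr W p hp hX
  constructor
  · intro h κ γ hκ hγ hv _ f hf ϖ hϖ I Y d
    obtain ⟨Lplus, Lminus, hL⟩ :=
      exists_isPollackPair pollack_exists_plusMinusPAdicLFunction_holds hp hf hgood hap
    obtain ⟨D⟩ := Kobayashi2003.nonempty_signedSelmerDualData W κ ε hγ
    obtain ⟨-, hDtor⟩ := h12 W p hp hgood hap κ γ hκ hγ ε D
    have hvϖ : padicValRat p ϖ = 0 := padicValRat_periodRatio_eq_zero h5 h3 W p hp hgood hirr f hf ϖ hϖ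
    exact (lowerClause_iff_charIdeal_le W p hirr hγ hf hϖ hvϖ hL D hDtor Y d).mp
      (h κ γ hκ hγ hv f hf ϖ hϖ Lplus Lminus hL D)
  · intro h κ γ hκ hγ hv _ f hf ϖ hϖ Lplus Lminus hL D
    obtain ⟨I⟩ := Kato2004.nonempty_iwasawaH1Data_holds W p κ γ hκ hγ
    obtain ⟨Y⟩ := W.nonempty_fineSelmerDualData κ hγ
    obtain ⟨d⟩ := hPkg W p f ϖ κ γ hp hgood hap hf hϖ hκ hγ hv ε I
    obtain ⟨-, hDtor⟩ := h12 W p hp hgood hap κ γ hκ hγ ε D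
    have hvϖ : padicValRat p ϖ = 0 := padicValRat_periodRatio_eq_zero h5 h3 W p hp hgood hirr f hf ϖ hϖ
    exact (lowerClause_iff_charIdeal_le W p hirr hγ hf hϖ hvϖ hL D hDtor Y d).mpr
      (h κ γ hκ hγ hv f hf ϖ hϖ I Y d)

/-- **Sign swap on a JOINT package.** Class X6, odd `p`, `h12`/`h5`/`h3` by name; `hJ`: for every frame and
every pinned `I` there are package data of signs `ε₁`, `ε₂` with THE SAME zeta submodule (Kobayashi's three
exact sequences in the proof of Thm. 7.4 all start at `𝐇¹(T)^Δ/Z(T)^Δ`; the tree's one-sign fact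
`thm62_63_73_signedColemanKato_zeta` forgets this, exactly as `Sprung2012.thm714seq_…_zeta` vs `…_zetaJoint`).
Then `KobayashiLowerDivisibility W p ε₁ → KobayashiLowerDivisibility W p ε₂`: the Eisenstein half for one
sign gives Kato's Eisenstein inclusion on `𝐇¹/Z`, which gives the Eisenstein half for the other sign.
[cite: Kobayashi2003, Thm. 7.4 and its proof (p. 13), §5 (p. 10)] -/
theorem X6.kobayashiLowerDivisibility_of_jointZ
    (h12 : Kobayashi2003.thm12_signedSelmerDual_finite_torsion)
    (h5 : realPeriodRat_eq_unit_mul_plusPeriod) (h3 : realPeriodRat_eq_unit_mul_plusPeriod_three)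
    (hp : p ≠ 2) (hX : ClassX6 W p) {ε₁ ε₂ : ℤˣ}
    (hJ : ∀ (κ : ZpExtension ℚ p) (γ : absoluteGaloisGroup ℚ),
      κ.IsCyclotomic → κ.IsTopGenerator γ → IsCyclotomicVariable p γ →
      ∀ [NeZero (W.conductorNorm ℤ)] (f : CuspForm (Gamma0 (W.conductorNorm ℤ)) 2),
        IsNewformOf W f → ∀ (ϖ : ℚ), (ϖ : ℝ) * W.realPeriodRat = plusPeriod f →
      ∀ (I : Kato2004.IwasawaH1Data W p κ γ),
        ∃ (d₁ : Kobayashi2003.SignedColemanKatoData W p f ϖ κ γ ε₁ I)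
          (d₂ : Kobayashi2003.SignedColemanKatoData W p f ϖ κ γ ε₂ I), d₁.Z = d₂.Z)
    (h : KobayashiLowerDivisibility W p ε₁) : KobayashiLowerDivisibility W p ε₂ := by
  have hgood := hX.1.1
  have hap := ClassX6.frobeniusTrace_eq_zero W p hp hX
  have hirr := ClassX6.irr W p hp hX
  intro κ γ hκ hγ hv _ f hf ϖ hϖ Lplus Lminus hL D₂
  obtain ⟨I⟩ := Kato2004.nonempty_iwasawaH1Data_holds W p κ γ hκ hγ
  obtain ⟨Y⟩ := W.nonempty_fineSelmerDualData κ hγ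
  obtain ⟨d₁, d₂, hZ⟩ := hJ κ γ hκ hγ hv f hf ϖ hϖ I
  obtain ⟨D₁⟩ := Kobayashi2003.nonempty_signedSelmerDualData W κ ε₁ hγ
  obtain ⟨-, hD₁tor⟩ := h12 W p hp hgood hap κ γ hκ hγ ε₁ D₁
  obtain ⟨-, hD₂tor⟩ := h12 W p hp hgood hap κ γ hκ hγ ε₂ D₂
  have hvϖ : padicValRat p ϖ = 0 := padicValRat_periodRatio_eq_zero h5 h3 W p hp hgood hirr f hf ϖ hϖ
  have hE₁ := (lowerClause_iff_charIdeal_le W p hirr hγ hf hϖ hvϖ hL D₁ hD₁tor Y d₁).mp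
    (h κ γ hκ hγ hv f hf ϖ hϖ Lplus Lminus hL D₁)
  rw [charIdeal_quot_eq_of_Z_eq W p d₁ d₂ hZ] at hE₁
  exact (lowerClause_iff_charIdeal_le W p hirr hγ hf hϖ hvϖ hL D₂ hD₂tor Y d₂).mpr hE₁

/-- **The crux's existential sign is idle on a joint package**: class X6, odd `p`, `h12`/`h5`/`h3` by name,
joint packages `hJ` for the two signs `(1, −1)`; then `(∃ ε, KobayashiLowerDivisibility W p ε) ↔
∀ ε, KobayashiLowerDivisibility W p ε` (`ℤˣ = {1, −1}` and `X6.kobayashiLowerDivisibility_of_jointZ` both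
ways). So cruxes 1/2/4 of the route (`∃ ε, …`) ask for Kato's Eisenstein half, no more, no less.
[cite: Kobayashi2003, Thm. 7.4 (p. 13)] -/
theorem X6.exists_kobayashiLowerDivisibility_iff_forall_of_jointZ
    (h12 : Kobayashi2003.thm12_signedSelmerDual_finite_torsion)
    (h5 : realPeriodRat_eq_unit_mul_plusPeriod) (h3 : realPeriodRat_eq_unit_mul_plusPeriod_three)
    (hp : p ≠ 2) (hX : ClassX6 W p)
    (hJ : ∀ (κ : ZpExtension ℚ p) (γ : absoluteGaloisGroup ℚ),
      κ.IsCyclotomic → κ.IsTopGenerator γ → IsCyclotomicVariable p γ →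
      ∀ [NeZero (W.conductorNorm ℤ)] (f : CuspForm (Gamma0 (W.conductorNorm ℤ)) 2),
        IsNewformOf W f → ∀ (ϖ : ℚ), (ϖ : ℝ) * W.realPeriodRat = plusPeriod f →
      ∀ (I : Kato2004.IwasawaH1Data W p κ γ),
        ∃ (d₁ : Kobayashi2003.SignedColemanKatoData W p f ϖ κ γ 1 I)
          (d₂ : Kobayashi2003.SignedColemanKatoData W p f ϖ κ γ (-1) I), d₁.Z = d₂.Z) :
    (∃ ε : ℤˣ, KobayashiLowerDivisibility W p ε) ↔ ∀ ε : ℤˣ, KobayashiLowerDivisibility W p ε := by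
  refine ⟨fun ⟨ε₀, h⟩ ε ↦ ?_, fun h ↦ ⟨1, h 1⟩⟩
  have hJ' : ∀ (κ : ZpExtension ℚ p) (γ : absoluteGaloisGroup ℚ),
      κ.IsCyclotomic → κ.IsTopGenerator γ → IsCyclotomicVariable p γ →
      ∀ [NeZero (W.conductorNorm ℤ)] (f : CuspForm (Gamma0 (W.conductorNorm ℤ)) 2),
        IsNewformOf W f → ∀ (ϖ : ℚ), (ϖ : ℝ) * W.realPeriodRat = plusPeriod f →
      ∀ (I : Kato2004.IwasawaH1Data W p κ γ),
        ∃ (d₁ : Kobayashi2003.SignedColemanKatoData W p f ϖ κ γ (-1) I)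
          (d₂ : Kobayashi2003.SignedColemanKatoData W p f ϖ κ γ 1 I), d₁.Z = d₂.Z := by
    intro κ γ hκ hγ hv _ f hf ϖ hϖ I
    obtain ⟨d₁, d₂, hZ⟩ := hJ κ γ hκ hγ hv f hf ϖ hϖ I
    exact ⟨d₂, d₁, hZ.symm⟩
  rcases Int.units_eq_one_or ε₀ with rfl | rfl <;> rcases Int.units_eq_one_or ε with rfl | rfl
  · exact h
  · exact X6.kobayashiLowerDivisibility_of_jointZ W p h12 h5 h3 hp hX hJ h
  · exact X6.kobayashiLowerDivisibility_of_jointZ W p h12 h5 h3 hp hX hJ' h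
  · exact h

/-! ## §6 The registered stubs of line `birth_musplit` in Kato currency (class X6, per sign) -/

/-- **The RATIONAL stub's clause for a sign `ε` ⟺ Kato's Eisenstein inclusion in `Λ ⊗ ℚ_p` on every
sign-`ε` package**: `(∀ admissible data D, ∃ g t, char X^ε = (g) ∧ L^ε ∣ p^t g)` ⟺
`(∀ frames I Y d, ∃ t, p^t · char X₀ ⊆ char(𝐇¹/Z))` — class X6, odd `p`, `h12`/`h5`/`h3`/`hPkg` by name.
This is the per-`(W, p, ε)` content of `BirthMuSplit.stub_five_le_rational` / `stub_three_rational`.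
[cite: Kobayashi2003, proof of Thm. 7.4 (p. 13)] [cite: Kato2004Asterisque, Conj. 12.10 (p. 224)] -/
theorem X6.forall_dvd_C_pow_mul_iff_kato
    (h12 : Kobayashi2003.thm12_signedSelmerDual_finite_torsion)
    (h5 : realPeriodRat_eq_unit_mul_plusPeriod) (h3 : realPeriodRat_eq_unit_mul_plusPeriod_three)
    (hPkg : Kobayashi2003.thm62_63_73_signedColemanKato_zeta)
    (hp : p ≠ 2) (hX : ClassX6 W p) (ε : ℤˣ) :
    (∀ (κ : ZpExtension ℚ p) (γ : absoluteGaloisGroup ℚ),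
      κ.IsCyclotomic → κ.IsTopGenerator γ → IsCyclotomicVariable p γ →
      ∀ [NeZero (W.conductorNorm ℤ)] (f : CuspForm (Gamma0 (W.conductorNorm ℤ)) 2),
        IsNewformOf W f → ∀ (ϖ : ℚ), (ϖ : ℝ) * W.realPeriodRat = plusPeriod f →
      ∀ (Lplus Lminus : IwasawaAlgebra p), IsPollackPair f p Lplus Lminus →
      ∀ (D : Kobayashi2003.SignedSelmerDualData W κ γ ε),
        ∃ (g : IwasawaAlgebra p) (t : ℕ), D.charIdeal = Ideal.span {g} ∧
          kobayashiL ε Lplus Lminus ∣ PowerSeries.C (p : ℤ_[p]) ^ t * g) ↔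
    ∀ (κ : ZpExtension ℚ p) (γ : absoluteGaloisGroup ℚ),
      κ.IsCyclotomic → κ.IsTopGenerator γ → IsCyclotomicVariable p γ →
    ∀ [NeZero (W.conductorNorm ℤ)] (f : CuspForm (Gamma0 (W.conductorNorm ℤ)) 2),
      IsNewformOf W f → ∀ (ϖ : ℚ), (ϖ : ℝ) * W.realPeriodRat = plusPeriod f →
    ∀ (I : Kato2004.IwasawaH1Data W p κ γ) (Y : W.FineSelmerDualData κ γ)
      (d : Kobayashi2003.SignedColemanKatoData W p f ϖ κ γ ε I),
      ∃ t : ℕ, Ideal.span {PowerSeries.C (p : ℤ_[p]) ^ t} * Module.charIdeal (IwasawaAlgebra p) Y.X ≤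
        Module.charIdeal (IwasawaAlgebra p) (I.H ⧸ d.Z) := by
  have hgood := hX.1.1
  have hap := ClassX6.frobeniusTrace_eq_zero W p hp hX
  have hirr := ClassX6.irr W p hp hX
  constructor
  · intro h κ γ hκ hγ hv _ f hf ϖ hϖ I Y d
    obtain ⟨Lplus, Lminus, hL⟩ :=
      exists_isPollackPair pollack_exists_plusMinusPAdicLFunction_holds hp hf hgood hap
    obtain ⟨D⟩ := Kobayashi2003.nonempty_signedSelmerDualData W κ ε hγ
    obtain ⟨-, hDtor⟩ := h12 W p hp hgood hap κ γ hκ hγ ε D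
    have hvϖ : padicValRat p ϖ = 0 := padicValRat_periodRatio_eq_zero h5 h3 W p hp hgood hirr f hf ϖ hϖ
    exact (dvd_C_pow_mul_iff_C_pow_mul_charIdeal_le W p hirr hγ hf hϖ hvϖ hL D hDtor Y d).mp
      (h κ γ hκ hγ hv f hf ϖ hϖ Lplus Lminus hL D)
  · intro h κ γ hκ hγ hv _ f hf ϖ hϖ Lplus Lminus hL D
    obtain ⟨I⟩ := Kato2004.nonempty_iwasawaH1Data_holds W p κ γ hκ hγ
    obtain ⟨Y⟩ := W.nonempty_fineSelmerDualData κ hγ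
    obtain ⟨d⟩ := hPkg W p f ϖ κ γ hp hgood hap hf hϖ hκ hγ hv ε I
    obtain ⟨-, hDtor⟩ := h12 W p hp hgood hap κ γ hκ hγ ε D
    have hvϖ : padicValRat p ϖ = 0 := padicValRat_periodRatio_eq_zero h5 h3 W p hp hgood hirr f hf ϖ hϖ
    exact (dvd_C_pow_mul_iff_C_pow_mul_charIdeal_le W p hirr hγ hf hϖ hvϖ hL D hDtor Y d).mpr
      (h κ γ hκ hγ hv f hf ϖ hϖ I Y d)

/-- **The `μ`-stub's clause for a sign `ε` ⟺ Kato's `μ`-inequality `μ(char 𝐇¹/Z) ≤ μ(char X₀)` on every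
sign-`ε` package** (all generators) — class X6, odd `p`, `h12`/`h5`/`h3`/`hPkg` by name. This is the
per-`(W, p)` content of `BirthMuSplit.stub_five_le_mu` / `stub_three_mu` at the sign `ε`.
[cite: Kobayashi2003, proof of Thm. 7.4 (p. 13)] [cite: GreenbergVatsal2000, p. 4, (1)–(2)]
[cite: Pollack2003, Conj. 6.3 (p. 548)] -/
theorem X6.forall_mu_le_iff_kato
    (h12 : Kobayashi2003.thm12_signedSelmerDual_finite_torsion)
    (h5 : realPeriodRat_eq_unit_mul_plusPeriod) (h3 : realPeriodRat_eq_unit_mul_plusPeriod_three)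
    (hPkg : Kobayashi2003.thm62_63_73_signedColemanKato_zeta)
    (hp : p ≠ 2) (hX : ClassX6 W p) (ε : ℤˣ) :
    (∀ (κ : ZpExtension ℚ p) (γ : absoluteGaloisGroup ℚ),
      κ.IsCyclotomic → κ.IsTopGenerator γ → IsCyclotomicVariable p γ →
      ∀ [NeZero (W.conductorNorm ℤ)] (f : CuspForm (Gamma0 (W.conductorNorm ℤ)) 2),
        IsNewformOf W f → ∀ (ϖ : ℚ), (ϖ : ℝ) * W.realPeriodRat = plusPeriod f →
      ∀ (Lplus Lminus : IwasawaAlgebra p), IsPollackPair f p Lplus Lminus →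
      ∀ (D : Kobayashi2003.SignedSelmerDualData W κ γ ε),
        ∃ g : IwasawaAlgebra p, D.charIdeal = Ideal.span {g} ∧
          MuLambda.mu (kobayashiL ε Lplus Lminus) ≤ MuLambda.mu g) ↔
    ∀ (κ : ZpExtension ℚ p) (γ : absoluteGaloisGroup ℚ),
      κ.IsCyclotomic → κ.IsTopGenerator γ → IsCyclotomicVariable p γ →
    ∀ [NeZero (W.conductorNorm ℤ)] (f : CuspForm (Gamma0 (W.conductorNorm ℤ)) 2),
      IsNewformOf W f → ∀ (ϖ : ℚ), (ϖ : ℝ) * W.realPeriodRat = plusPeriod f →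
    ∀ (I : Kato2004.IwasawaH1Data W p κ γ) (Y : W.FineSelmerDualData κ γ)
      (d : Kobayashi2003.SignedColemanKatoData W p f ϖ κ γ ε I) (z y : IwasawaAlgebra p),
      Module.charIdeal (IwasawaAlgebra p) (I.H ⧸ d.Z) = Ideal.span {z} →
      Module.charIdeal (IwasawaAlgebra p) Y.X = Ideal.span {y} → MuLambda.mu z ≤ MuLambda.mu y := by
  have hgood := hX.1.1
  have hap := ClassX6.frobeniusTrace_eq_zero W p hp hX
  have hirr := ClassX6.irr W p hp hX
  constructor
  · intro h κ γ hκ hγ hv _ f hf ϖ hϖ I Y d z y hz hy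
    obtain ⟨Lplus, Lminus, hL⟩ :=
      exists_isPollackPair pollack_exists_plusMinusPAdicLFunction_holds hp hf hgood hap
    obtain ⟨D⟩ := Kobayashi2003.nonempty_signedSelmerDualData W κ ε hγ
    obtain ⟨-, hDtor⟩ := h12 W p hp hgood hap κ γ hκ hγ ε D
    have hvϖ : padicValRat p ϖ = 0 := padicValRat_periodRatio_eq_zero h5 h3 W p hp hgood hirr f hf ϖ hϖ
    exact (mu_le_iff_mu_le W p hirr hγ hf hϖ hvϖ hL D hDtor Y d).mp
      (h κ γ hκ hγ hv f hf ϖ hϖ Lplus Lminus hL D) z y hz hy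
  · intro h κ γ hκ hγ hv _ f hf ϖ hϖ Lplus Lminus hL D
    obtain ⟨I⟩ := Kato2004.nonempty_iwasawaH1Data_holds W p κ γ hκ hγ
    obtain ⟨Y⟩ := W.nonempty_fineSelmerDualData κ hγ
    obtain ⟨d⟩ := hPkg W p f ϖ κ γ hp hgood hap hf hϖ hκ hγ hv ε I
    obtain ⟨-, hDtor⟩ := h12 W p hp hgood hap κ γ hκ hγ ε D
    have hvϖ : padicValRat p ϖ = 0 := padicValRat_periodRatio_eq_zero h5 h3 W p hp hgood hirr f hf ϖ hϖ
    exact (mu_le_iff_mu_le W p hirr hγ hf hϖ hvϖ hL D hDtor Y d).mpr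
      (h κ γ hκ hγ hv f hf ϖ hϖ I Y d)

/-- **On a joint package the `μ`-clause is sign-blind**: class X6, odd `p`, `h12`/`h5`/`h3` by name, joint
packages `hJ` for `(ε₁, ε₂)`; the `μ`-stub's clause for `ε₁` gives it for `ε₂` — `μ(L^{ε₁}) ≤ μ(char X^{ε₁})
⟹ μ(L^{ε₂}) ≤ μ(char X^{ε₂})`, both being `μ(char 𝐇¹/Z) ≤ μ(char X₀)`. So the `∃ ε` of
`BirthMuSplit.stub_*_mu` is as strong as `∀ ε` modulo published facts and the joint `Z(T)`.
[cite: Kobayashi2003, proof of Thm. 7.4 (p. 13)] [cite: Pollack2003, Conj. 6.3 (p. 548)] -/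
theorem X6.forall_mu_le_of_jointZ
    (h12 : Kobayashi2003.thm12_signedSelmerDual_finite_torsion)
    (h5 : realPeriodRat_eq_unit_mul_plusPeriod) (h3 : realPeriodRat_eq_unit_mul_plusPeriod_three)
    (hp : p ≠ 2) (hX : ClassX6 W p) {ε₁ ε₂ : ℤˣ}
    (hJ : ∀ (κ : ZpExtension ℚ p) (γ : absoluteGaloisGroup ℚ),
      κ.IsCyclotomic → κ.IsTopGenerator γ → IsCyclotomicVariable p γ →
      ∀ [NeZero (W.conductorNorm ℤ)] (f : CuspForm (Gamma0 (W.conductorNorm ℤ)) 2),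
        IsNewformOf W f → ∀ (ϖ : ℚ), (ϖ : ℝ) * W.realPeriodRat = plusPeriod f →
      ∀ (I : Kato2004.IwasawaH1Data W p κ γ),
        ∃ (d₁ : Kobayashi2003.SignedColemanKatoData W p f ϖ κ γ ε₁ I)
          (d₂ : Kobayashi2003.SignedColemanKatoData W p f ϖ κ γ ε₂ I), d₁.Z = d₂.Z)
    (h : ∀ (κ : ZpExtension ℚ p) (γ : absoluteGaloisGroup ℚ),
      κ.IsCyclotomic → κ.IsTopGenerator γ → IsCyclotomicVariable p γ →
      ∀ [NeZero (W.conductorNorm ℤ)] (f : CuspForm (Gamma0 (W.conductorNorm ℤ)) 2),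
        IsNewformOf W f → ∀ (ϖ : ℚ), (ϖ : ℝ) * W.realPeriodRat = plusPeriod f →
      ∀ (Lplus Lminus : IwasawaAlgebra p), IsPollackPair f p Lplus Lminus →
      ∀ (D : Kobayashi2003.SignedSelmerDualData W κ γ ε₁),
        ∃ g : IwasawaAlgebra p, D.charIdeal = Ideal.span {g} ∧
          MuLambda.mu (kobayashiL ε₁ Lplus Lminus) ≤ MuLambda.mu g) :
    ∀ (κ : ZpExtension ℚ p) (γ : absoluteGaloisGroup ℚ),
      κ.IsCyclotomic → κ.IsTopGenerator γ → IsCyclotomicVariable p γ →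
      ∀ [NeZero (W.conductorNorm ℤ)] (f : CuspForm (Gamma0 (W.conductorNorm ℤ)) 2),
        IsNewformOf W f → ∀ (ϖ : ℚ), (ϖ : ℝ) * W.realPeriodRat = plusPeriod f →
      ∀ (Lplus Lminus : IwasawaAlgebra p), IsPollackPair f p Lplus Lminus →
      ∀ (D : Kobayashi2003.SignedSelmerDualData W κ γ ε₂),
        ∃ g : IwasawaAlgebra p, D.charIdeal = Ideal.span {g} ∧
          MuLambda.mu (kobayashiL ε₂ Lplus Lminus) ≤ MuLambda.mu g := by
  have hgood := hX.1.1
  have hap := ClassX6.frobeniusTrace_eq_zero W p hp hX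
  have hirr := ClassX6.irr W p hp hX
  intro κ γ hκ hγ hv _ f hf ϖ hϖ Lplus Lminus hL D₂
  obtain ⟨I⟩ := Kato2004.nonempty_iwasawaH1Data_holds W p κ γ hκ hγ
  obtain ⟨Y⟩ := W.nonempty_fineSelmerDualData κ hγ
  obtain ⟨d₁, d₂, hZ⟩ := hJ κ γ hκ hγ hv f hf ϖ hϖ I
  obtain ⟨D₁⟩ := Kobayashi2003.nonempty_signedSelmerDualData W κ ε₁ hγ
  obtain ⟨-, hD₁tor⟩ := h12 W p hp hgood hap κ γ hκ hγ ε₁ D₁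
  obtain ⟨-, hD₂tor⟩ := h12 W p hp hgood hap κ γ hκ hγ ε₂ D₂
  have hvϖ : padicValRat p ϖ = 0 := padicValRat_periodRatio_eq_zero h5 h3 W p hp hgood hirr f hf ϖ hϖ
  have hK := (mu_le_iff_mu_le W p hirr hγ hf hϖ hvϖ hL D₁ hD₁tor Y d₁).mp
    (h κ γ hκ hγ hv f hf ϖ hϖ Lplus Lminus hL D₁)
  refine (mu_le_iff_mu_le W p hirr hγ hf hϖ hvϖ hL D₂ hD₂tor Y d₂).mpr fun z y hz hy ↦ hK z y ?_ hy
  rwa [charIdeal_quot_eq_of_Z_eq W p d₁ d₂ hZ]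

/-- **On a joint package the RATIONAL clause is sign-blind**: class X6, odd `p`, `h12`/`h5`/`h3` by name,
joint packages `hJ` for `(ε₁, ε₂)`; the rational stub's clause for `ε₁` gives it for `ε₂` (both being
`p^t · char X₀ ⊆ char(𝐇¹/Z)`). So the `∀ ε` of `BirthMuSplit.stub_*_rational` costs nothing beyond one sign
modulo published facts and the joint `Z(T)` — the kernel form of "both signed Eisenstein halves are
rationally Kato's" (Kobayashi Thm. 7.4). [cite: Kobayashi2003, Thm. 7.4 and its proof (p. 13)] -/
theorem X6.forall_dvd_C_pow_mul_of_jointZ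
    (h12 : Kobayashi2003.thm12_signedSelmerDual_finite_torsion)
    (h5 : realPeriodRat_eq_unit_mul_plusPeriod) (h3 : realPeriodRat_eq_unit_mul_plusPeriod_three)
    (hp : p ≠ 2) (hX : ClassX6 W p) {ε₁ ε₂ : ℤˣ}
    (hJ : ∀ (κ : ZpExtension ℚ p) (γ : absoluteGaloisGroup ℚ),
      κ.IsCyclotomic → κ.IsTopGenerator γ → IsCyclotomicVariable p γ →
      ∀ [NeZero (W.conductorNorm ℤ)] (f : CuspForm (Gamma0 (W.conductorNorm ℤ)) 2),
        IsNewformOf W f → ∀ (ϖ : ℚ), (ϖ : ℝ) * W.realPeriodRat = plusPeriod f →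
      ∀ (I : Kato2004.IwasawaH1Data W p κ γ),
        ∃ (d₁ : Kobayashi2003.SignedColemanKatoData W p f ϖ κ γ ε₁ I)
          (d₂ : Kobayashi2003.SignedColemanKatoData W p f ϖ κ γ ε₂ I), d₁.Z = d₂.Z)
    (h : ∀ (κ : ZpExtension ℚ p) (γ : absoluteGaloisGroup ℚ),
      κ.IsCyclotomic → κ.IsTopGenerator γ → IsCyclotomicVariable p γ →
      ∀ [NeZero (W.conductorNorm ℤ)] (f : CuspForm (Gamma0 (W.conductorNorm ℤ)) 2),
        IsNewformOf W f → ∀ (ϖ : ℚ), (ϖ : ℝ) * W.realPeriodRat = plusPeriod f →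
      ∀ (Lplus Lminus : IwasawaAlgebra p), IsPollackPair f p Lplus Lminus →
      ∀ (D : Kobayashi2003.SignedSelmerDualData W κ γ ε₁),
        ∃ (g : IwasawaAlgebra p) (t : ℕ), D.charIdeal = Ideal.span {g} ∧
          kobayashiL ε₁ Lplus Lminus ∣ PowerSeries.C (p : ℤ_[p]) ^ t * g) :
    ∀ (κ : ZpExtension ℚ p) (γ : absoluteGaloisGroup ℚ),
      κ.IsCyclotomic → κ.IsTopGenerator γ → IsCyclotomicVariable p γ →
      ∀ [NeZero (W.conductorNorm ℤ)] (f : CuspForm (Gamma0 (W.conductorNorm ℤ)) 2),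
        IsNewformOf W f → ∀ (ϖ : ℚ), (ϖ : ℝ) * W.realPeriodRat = plusPeriod f →
      ∀ (Lplus Lminus : IwasawaAlgebra p), IsPollackPair f p Lplus Lminus →
      ∀ (D : Kobayashi2003.SignedSelmerDualData W κ γ ε₂),
        ∃ (g : IwasawaAlgebra p) (t : ℕ), D.charIdeal = Ideal.span {g} ∧
          kobayashiL ε₂ Lplus Lminus ∣ PowerSeries.C (p : ℤ_[p]) ^ t * g := by
  have hgood := hX.1.1
  have hap := ClassX6.frobeniusTrace_eq_zero W p hp hX
  have hirr := ClassX6.irr W p hp hX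
  intro κ γ hκ hγ hv _ f hf ϖ hϖ Lplus Lminus hL D₂
  obtain ⟨I⟩ := Kato2004.nonempty_iwasawaH1Data_holds W p κ γ hκ hγ
  obtain ⟨Y⟩ := W.nonempty_fineSelmerDualData κ hγ
  obtain ⟨d₁, d₂, hZ⟩ := hJ κ γ hκ hγ hv f hf ϖ hϖ I
  obtain ⟨D₁⟩ := Kobayashi2003.nonempty_signedSelmerDualData W κ ε₁ hγ
  obtain ⟨-, hD₁tor⟩ := h12 W p hp hgood hap κ γ hκ hγ ε₁ D₁
  obtain ⟨-, hD₂tor⟩ := h12 W p hp hgood hap κ γ hκ hγ ε₂ D₂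
  have hvϖ : padicValRat p ϖ = 0 := padicValRat_periodRatio_eq_zero h5 h3 W p hp hgood hirr f hf ϖ hϖ
  obtain ⟨t, ht⟩ := (dvd_C_pow_mul_iff_C_pow_mul_charIdeal_le W p hirr hγ hf hϖ hvϖ hL D₁ hD₁tor Y d₁).mp
    (h κ γ hκ hγ hv f hf ϖ hϖ Lplus Lminus hL D₁)
  rw [charIdeal_quot_eq_of_Z_eq W p d₁ d₂ hZ] at ht
  exact (dvd_C_pow_mul_iff_C_pow_mul_charIdeal_le W p hirr hγ hf hϖ hvϖ hL D₂ hD₂tor Y d₂).mpr ⟨t, ht⟩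

end X6

end Summit.BirchSwinnertonDyer.BirchSwinnertonDyer.Theorems.SignDefect

end
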